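import Summits.QuantumFields.Balaban3D.Proofs.AxialGaugeChartSU2
import Summits.QuantumFields.Balaban3D.Proofs.FibreSplit

/-!
# `Summit.QuantumFields.Balaban3D.Proofs.FluctChartSU2` — the fluctuation integral of `…Proofs.AxialGaugeShift` as an integral over the FREE bonds
# only (the forest/crossing coordinates are dummy and integrate out), and — for `G = SU(2)` — over `𝔰𝔲(2)`-valued variables on the free bonds:
# `∫ F(fluct W) dW = ∫ F(fluctFree w) d(⊗_{free} Haar)(w) = ∫ F(fluctFree (exp ∘ A)) d(⊗_{free} expMeasure)(A)` — the integration domain of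
# [Balaban1985UV3] (18)/(22) («|Ω₁*| = the number of bonds belonging to Ω₁ minus the number of bonds in Ω₁^{(1)} and minus the number of bonds in
# the axial gauge fixing set» variables) for the lane's averaging at `Ω₁ = T` (seat p4, lane `pub-balaban3d`; F1 + (18) of HOME/drafts/p4/FIBRE49.md)

HONEST FRAMING (lane PLAN.md §0, binding): see `…Proofs.SectAFirstStep`.  [folklore] Fubini over a bond partition (`…Proofs.FibreSplit`) and the
SU(2) product chart of `…Proofs.ProductChartSU2` on an arbitrary finite index type; nothing of the paper is asserted.
-/

noncomputable section

namespace Summit.QuantumFields.Balaban3D.Proofs.FluctChartSU2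

open _root_.MeasureTheory
open Literature.MathematicalPhysics.QuantumFieldTheory.Balaban1983to89
open Literature.MathematicalPhysics.QuantumFieldTheory.Balaban1983to89.T4HaarSU2ExpChart (expPoint expMeasure measurable_expPoint
  map_expPoint_expMeasure)
open Summit.QuantumFields.Balaban3D.Carriers
open Summit.QuantumFields.Balaban3D.Proofs.AxialGauge
open Summit.QuantumFields.Balaban3D.Proofs.AxialGaugeFix
open Summit.QuantumFields.Balaban3D.Proofs.AxialGaugeShift
open Summit.QuantumFields.Balaban3D.Proofs.FibreSplit (splitEquiv integral_fieldMeasure_split)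

variable {P : Params} {j : ℕ} {G : Type*} [GaugeGroup G]

/-! ## §1 The dummy coordinates of the fluctuation field integrate out -/

/-- A bond is DUMMY for the fluctuation field if it lies in the radial forest or is a crossing bond (there `fluct W = 1`); the others are print's
`|T*|` free bonds. [cite: Balaban1985UV3, p.260 (after (18))] -/
def IsDummy (b : PBond P j) : Prop := b ∈ forest P j ∨ ∃ c : PBond P (j + 1), crossBond c = b

omit [GaugeGroup G] in
/-- Classical decidability of `IsDummy` (for the bond splitting). [folklore] -/
noncomputable instance instDecidablePredIsDummy : DecidablePred (IsDummy (P := P) (j := j)) := Classical.decPred _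

variable [DecidableEq (PBond P j)]

/-- The fluctuation field depends on the bond variables OFF the dummy bonds only. [folklore] -/
theorem fluct_congr (hj : j + 1 ≤ P.m + P.K) {W W' : GaugeField P j G} (h : ∀ b, ¬ IsDummy b → W b = W' b) :
    (fluct W : GaugeField P j G) = fluct W' := by
  funext b
  unfold fluct
  by_cases hT : b ∈ forest P j
  · rw [axGlue_of_mem_forest hj _ _ hT, axGlue_of_mem_forest hj _ _ hT]
  · by_cases hX : ∃ c : PBond P (j + 1), crossBond c = b
    · obtain ⟨c, rfl⟩ := hX
      rw [axGlue_cross hj, axGlue_cross hj]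
    · have hX' : ∀ c, b ≠ crossBond c := fun c hc => hX ⟨c, hc.symm⟩
      rw [axGlue_free _ _ hT hX', axGlue_free _ _ hT hX', h b (fun hd => hd.elim hT hX)]

variable [MeasurableSpace G] [HaarData G]

/-- THE FLUCTUATION FIELD OF THE FREE VARIABLES: glue the free bond variables `w` with `1` on the dummy bonds, then `fluct`. [folklore] -/
def fluctFree (w : {b : PBond P j // ¬ IsDummy b} → G) : GaugeField P j G :=
  fluct ((splitEquiv (IsDummy (P := P) (j := j))).symm (w, fun _ => 1))

/-- **The dummy coordinates integrate out**: `∫ F(fluct W) dW = ∫ F(fluctFree w) d(⊗_{free bonds} Haar)(w)` for every `F` with `F ∘ fluct`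
integrable (Fubini over the bond partition free/dummy; the inner integral over the dummies is that of a constant against a probability measure).
[cite: Balaban1985UV3, p.260 (after (18))] -/
theorem integral_fluct_eq_integral_free {E : Type*} [NormedAddCommGroup E] [NormedSpace ℝ E] [CompleteSpace E] (hj : j + 1 ≤ P.m + P.K)
    (F : GaugeField P j G → E) (hF : Integrable (fun W => F (fluct W)) (fieldMeasure P j G)) :
    ∫ W, F (fluct W) ∂(fieldMeasure P j G) =
      ∫ w, F (fluctFree w) ∂(Measure.pi fun _ : {b : PBond P j // ¬ IsDummy b} => (HaarData.haar : Measure G)) := by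
  rw [integral_fieldMeasure_split (IsDummy (P := P) (j := j)) (fun W => F (fluct W)) hF]
  refine integral_congr_ae (Filter.Eventually.of_forall fun wZ => ?_)
  have hconst : ∀ wB : {b : PBond P j // ¬¬ IsDummy b} → G,
      F (fluct ((splitEquiv (IsDummy (P := P) (j := j))).symm (wZ, wB))) = F (fluctFree wZ) := fun wB => by
    unfold fluctFree
    have hc := fluct_congr (G := G) hj (W := (splitEquiv (IsDummy (P := P) (j := j))).symm (wZ, wB))
      (W' := (splitEquiv (IsDummy (P := P) (j := j))).symm (wZ, fun _ => 1)) (fun b hb => by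
        show (if h : ¬ IsDummy b then wZ ⟨b, h⟩ else wB ⟨b, h⟩) = (if h : ¬ IsDummy b then wZ ⟨b, h⟩ else (1 : G))
        rw [dif_pos hb, dif_pos hb])
    rw [hc]
  simp_rw [hconst]
  rw [integral_const, probReal_univ, one_smul]

/-! ## §2 `G = SU(2)`: the free variables in the exponential chart -/

section SU2

open Summit.QuantumFields.Balaban3D.Proofs.ProductChartSU2 (SU2)

/-- The SU(2) product chart on an ARBITRARY finite index type (`…ProductChartSU2.measurePreserving_expField` is the case of all bonds):
`A ↦ (i ↦ exp(iA(i)))` pushes `⊗_i expMeasure` to `⊗_i Haar`. [cite: Balaban1985UV3, (18) p.260] -/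
theorem measurePreserving_expPi (ι : Type*) [Fintype ι] :
    MeasurePreserving (fun (A : ι → EuclideanSpace ℝ (Fin 3)) (i : ι) => expPoint (A i))
      (Measure.pi fun _ : ι => expMeasure) (Measure.pi fun _ : ι => (HaarData.haar : Measure SU2)) := by
  have h : ∀ _ : ι, MeasurePreserving expPoint expMeasure (HaarData.haar : Measure SU2) := fun _ =>
    ⟨measurable_expPoint, map_expPoint_expMeasure⟩
  exact measurePreserving_pi (fun _ : ι => expMeasure) (fun _ => (HaarData.haar : Measure SU2)) h

/-- Integration over `SU(2)`-valued functions on a finite index type in the exponential chart. [cite: Balaban1985UV3, (18) p.260] -/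
theorem integral_pi_su2_eq_integral_chart {ι : Type*} [Fintype ι] {E : Type*} [NormedAddCommGroup E] [NormedSpace ℝ E]
    (f : (ι → SU2) → E) (hf : AEStronglyMeasurable f (Measure.pi fun _ : ι => (HaarData.haar : Measure SU2))) :
    ∫ w, f w ∂(Measure.pi fun _ : ι => (HaarData.haar : Measure SU2)) =
      ∫ A, f (fun i => expPoint (A i)) ∂(Measure.pi fun _ : ι => expMeasure) := by
  have hmp := measurePreserving_expPi ι
  rw [← hmp.map_eq, integral_map (hmp.measurable.aemeasurable)]
  rw [hmp.map_eq]; exact hf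

/-- **THE FLUCTUATION INTEGRAL OVER `𝔰𝔲(2)`-VALUED FREE VARIABLES** (G = SU(2), standing range): for `F ∘ fluct` integrable and `F ∘ fluctFree`
a.e.-strongly measurable, `∫ F(fluct W) dW = ∫ F(fluctFree (i ↦ exp(iA(i)))) d(⊗_{free} expMeasure)(A)` — print's «∫ dA′↾_{Ω₁} … σ(A′)» over exactly the
`|T*|` free bonds. [cite: Balaban1985UV3, (18) p.260 + (22) p.261] -/
theorem integral_fluct_su2_eq_integral_chart {E : Type*} [NormedAddCommGroup E] [NormedSpace ℝ E] [CompleteSpace E] (hj : j + 1 ≤ P.m + P.K)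
    (F : GaugeField P j SU2 → E) (hF : Integrable (fun W => F (fluct W)) (fieldMeasure P j SU2))
    (hFm : AEStronglyMeasurable (fun w : {b : PBond P j // ¬ IsDummy b} → SU2 => F (fluctFree w))
      (Measure.pi fun _ : {b : PBond P j // ¬ IsDummy b} => (HaarData.haar : Measure SU2))) :
    ∫ W, F (fluct W) ∂(fieldMeasure P j SU2) =
      ∫ A, F (fluctFree fun i => expPoint (A i)) ∂(Measure.pi fun _ : {b : PBond P j // ¬ IsDummy b} => expMeasure) := by
  rw [integral_fluct_eq_integral_free hj F hF]
  exact integral_pi_su2_eq_integral_chart _ hFm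

end SU2

end Summit.QuantumFields.Balaban3D.Proofs.FluctChartSU2

end
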